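import Mathlib.Analysis.SpecialFunctions.Exp
import HarnessLib

/-!
# The scalar recursion of the refined split flow: a pollution budget closes the hypotheses `hθ`, `hstep`

Topic `MathematicalPhysics/QuantumLattice`; the bookkeeping half of the multiscale bounds (cell gate-hubbard-kl, R0-SCOPE-4 W7a).
`GrassmannFlowDBRefined.iterEffAction_splitFlow_geometric_refined_of_gramBounded` asks, at every scale `j < K`, for
`x_j = e²(κ_j+ρ_j)t_j < 1`, `θ_j = e α_j (Λ_j + D̃_j)/κ_j² < 1` (`D̃_j = D_j x_j²/(1-x_j²)`) and the step inequality
`e (D̃_j + (Λ_j + D̃_j) θ_j/(1-θ_j)) ≤ D_{j+1}`.  Here the sequence `D_j` is DEFINED by the step recursion with equality from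
`D_0 = 0` (`flowD`), so that `hstep` holds trivially, and the remaining content — `θ_j` stays small — is reduced to a LINEAR budget:
writing `a_j = e α_j/κ_j²`, `g_j = x_j²/(1-x_j²)`, `σ_j = a_j Λ_j` (the tracked part of `θ_j`) and `U_j = a_j g_j D_j` (the pollution),
one has `θ_j = σ_j + U_j` and, as long as `θ_j ≤ ε ≤ 1/2`, `U_{j+1} ≤ Γ_j ((1+2ε) U_j + 2ε σ_j)` with the growth factor
`Γ_j = e a_{j+1} g_{j+1}/a_j` (Benfatto–Giuliani–Mastropietro 2006, §2.8: the inductive bounds (2.85)–(2.88) behind Thm 2.1).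

* `flowD` — the recursively defined `D_j`; `flowD_nonneg`; `flowD_succ` (the step with equality);
* **`flowD_budget`** — if a budget `B_j ≥ 0` satisfies `Γ_j((1+2ε)B_j + 2εσ_j) ≤ B_{j+1}` and `σ_j + B_j ≤ ε` for `j ≤ K`, then
  `a_j g_j D_j ≤ B_j` and `θ_j ≤ ε` for all `j ≤ K`;
* `flowD_hθ`, `flowD_hstep` — the two hypotheses of the refined flow theorem in its literal form.

Everything is proved; `flowD` is the only definition; no named facts.

## Sources

G. Benfatto, A. Giuliani, V. Mastropietro, Ann. Henri Poincaré 7 (2006) 809–898, §2.8 (2.85)–(2.88) (`BenfattoGiulianiMastropietro2006`).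
-/

noncomputable section

namespace Literature.MathematicalPhysics.QuantumLattice

open Real

/-- **The recursively defined deviation constants** `D_0 = 0`,
`D_{j+1} = e (D̃_j + (Λ_j + D̃_j) θ_j/(1-θ_j))`, `D̃_j = D_j x_j²/(1-x_j²)`, `θ_j = e α_j (Λ_j + D̃_j)/κ_j²`.
[cite: BenfattoGiulianiMastropietro2006, §2.8 (2.85)-(2.88)] -/
def flowD (x α κ Λ : ℕ → ℝ) : ℕ → ℝ
  | 0 => 0
  | j + 1 =>
    exp 1 * (flowD x α κ Λ j * x j ^ 2 / (1 - x j ^ 2) +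
      (Λ j + flowD x α κ Λ j * x j ^ 2 / (1 - x j ^ 2)) *
        (exp 1 * α j * (Λ j + flowD x α κ Λ j * x j ^ 2 / (1 - x j ^ 2)) / κ j ^ 2) /
          (1 - exp 1 * α j * (Λ j + flowD x α κ Λ j * x j ^ 2 / (1 - x j ^ 2)) / κ j ^ 2))

variable {x α κ Λ : ℕ → ℝ}

/-- `D_0 = 0`. [cite: BenfattoGiulianiMastropietro2006, §2.8 (2.85)-(2.88)] -/
@[simp] theorem flowD_zero : flowD x α κ Λ 0 = 0 := rfl

/-- The step, with equality. [cite: BenfattoGiulianiMastropietro2006, §2.8 (2.85)-(2.88)] -/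
theorem flowD_succ (j : ℕ) :
    flowD x α κ Λ (j + 1) =
      exp 1 * (flowD x α κ Λ j * x j ^ 2 / (1 - x j ^ 2) +
        (Λ j + flowD x α κ Λ j * x j ^ 2 / (1 - x j ^ 2)) *
          (exp 1 * α j * (Λ j + flowD x α κ Λ j * x j ^ 2 / (1 - x j ^ 2)) / κ j ^ 2) /
            (1 - exp 1 * α j * (Λ j + flowD x α κ Λ j * x j ^ 2 / (1 - x j ^ 2)) / κ j ^ 2)) := rfl

/-- **The budget lemma.**  Let `0 ≤ α_j`, `0 < κ_j`, `0 ≤ Λ_j`, `x_j² < 1`, `ε < 1`, and let `P_j ≥ 0` be a budget with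
`e (g_j P_j + (Λ_j + g_j P_j) ε/(1-ε)) ≤ P_{j+1}` (`g_j = x_j²/(1-x_j²)`) for `j < K` and `e α_j (Λ_j + g_j P_j)/κ_j² ≤ ε` for `j ≤ K`.
Then `0 ≤ D_j ≤ P_j` and `θ_j ≤ ε` for all `j ≤ K`. [cite: BenfattoGiulianiMastropietro2006, §2.8 (2.85)-(2.88)] -/
theorem flowD_budget (hα : ∀ j, 0 ≤ α j) (hκ : ∀ j, 0 < κ j) (hΛ : ∀ j, 0 ≤ Λ j) (hx : ∀ j, x j ^ 2 < 1)
    {ε : ℝ} (hε1 : ε < 1) (P : ℕ → ℝ) (hP : ∀ j, 0 ≤ P j) (K : ℕ)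
    (hPstep : ∀ j < K, exp 1 * (P j * x j ^ 2 / (1 - x j ^ 2) + (Λ j + P j * x j ^ 2 / (1 - x j ^ 2)) * (ε / (1 - ε))) ≤ P (j + 1))
    (hsmall : ∀ j ≤ K, exp 1 * α j * (Λ j + P j * x j ^ 2 / (1 - x j ^ 2)) / κ j ^ 2 ≤ ε) :
    ∀ j ≤ K, 0 ≤ flowD x α κ Λ j ∧ flowD x α κ Λ j ≤ P j ∧
      exp 1 * α j * (Λ j + flowD x α κ Λ j * x j ^ 2 / (1 - x j ^ 2)) / κ j ^ 2 ≤ ε := by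
  -- the invariant `0 ≤ D_j ≤ P_j`, by induction
  have hg : ∀ j, 0 ≤ x j ^ 2 / (1 - x j ^ 2) := fun j => div_nonneg (sq_nonneg _) (by linarith [hx j])
  have hθ_of : ∀ j ≤ K, 0 ≤ flowD x α κ Λ j → flowD x α κ Λ j ≤ P j →
      exp 1 * α j * (Λ j + flowD x α κ Λ j * x j ^ 2 / (1 - x j ^ 2)) / κ j ^ 2 ≤ ε := by
    intro j hj h0 hP'
    refine le_trans ?_ (hsmall j hj)
    have h1 : flowD x α κ Λ j * x j ^ 2 / (1 - x j ^ 2) ≤ P j * x j ^ 2 / (1 - x j ^ 2) := by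
      rw [mul_div_assoc, mul_div_assoc]; exact mul_le_mul_of_nonneg_right hP' (hg j)
    have h2 : 0 ≤ exp 1 * α j := mul_nonneg (exp_pos 1).le (hα j)
    exact div_le_div_of_nonneg_right (mul_le_mul_of_nonneg_left (by linarith) h2) (pow_pos (hκ j) 2).le
  have hinv : ∀ j ≤ K, 0 ≤ flowD x α κ Λ j ∧ flowD x α κ Λ j ≤ P j := by
    intro j
    induction j with
    | zero => intro _; exact ⟨le_rfl, by rw [flowD_zero]; exact hP 0⟩
    | succ j ih =>
      intro hj
      have hjK : j < K := Nat.lt_of_succ_le hj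
      obtain ⟨h0, hPj⟩ := ih hjK.le
      have hθ := hθ_of j hjK.le h0 hPj
      set D := flowD x α κ Λ j with hD
      set g := x j ^ 2 / (1 - x j ^ 2) with hgj
      set θ := exp 1 * α j * (Λ j + D * x j ^ 2 / (1 - x j ^ 2)) / κ j ^ 2 with hθdef
      have hθ0 : 0 ≤ θ := by
        rw [hθdef]
        refine div_nonneg (mul_nonneg (mul_nonneg (exp_pos 1).le (hα j)) ?_) (pow_pos (hκ j) 2).le
        have : 0 ≤ D * x j ^ 2 / (1 - x j ^ 2) := by rw [mul_div_assoc]; exact mul_nonneg h0 (hg j)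
        linarith [hΛ j]
      have hθ1 : θ < 1 := lt_of_le_of_lt hθ hε1
      have hDg : 0 ≤ D * x j ^ 2 / (1 - x j ^ 2) := by rw [mul_div_assoc]; exact mul_nonneg h0 (hg j)
      have hDgP : D * x j ^ 2 / (1 - x j ^ 2) ≤ P j * x j ^ 2 / (1 - x j ^ 2) := by
        rw [mul_div_assoc, mul_div_assoc]; exact mul_le_mul_of_nonneg_right hPj (hg j)
      have hfrac : θ / (1 - θ) ≤ ε / (1 - ε) := by
        rw [div_le_div_iff₀ (by linarith) (by linarith)]; nlinarith
      have hfrac0 : 0 ≤ θ / (1 - θ) := div_nonneg hθ0 (by linarith)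
      rw [flowD_succ, ← hD]
      refine ⟨?_, ?_⟩
      · refine mul_nonneg (exp_pos 1).le (add_nonneg hDg (div_nonneg (mul_nonneg (by linarith [hΛ j]) hθ0) (by linarith)))
      · refine le_trans ?_ (hPstep j hjK)
        refine mul_le_mul_of_nonneg_left ?_ (exp_pos 1).le
        have hA : (Λ j + D * x j ^ 2 / (1 - x j ^ 2)) * θ / (1 - θ) = (Λ j + D * x j ^ 2 / (1 - x j ^ 2)) * (θ / (1 - θ)) := by
          ring
        rw [hA]
        exact add_le_add hDgP (mul_le_mul (by linarith) hfrac hfrac0 (by linarith [hΛ j]))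
  intro j hj
  obtain ⟨h0, hPj⟩ := hinv j hj
  exact ⟨h0, hPj, hθ_of j hj h0 hPj⟩

/-- **Hypothesis `hθ` of the refined flow theorem** under a budget (`ε < 1`). [cite: BenfattoGiulianiMastropietro2006, §2.8 (2.85)-(2.88)] -/
theorem flowD_hθ (hα : ∀ j, 0 ≤ α j) (hκ : ∀ j, 0 < κ j) (hΛ : ∀ j, 0 ≤ Λ j) (hx : ∀ j, x j ^ 2 < 1)
    {ε : ℝ} (hε1 : ε < 1) (P : ℕ → ℝ) (hP : ∀ j, 0 ≤ P j) (K : ℕ)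
    (hPstep : ∀ j < K, exp 1 * (P j * x j ^ 2 / (1 - x j ^ 2) + (Λ j + P j * x j ^ 2 / (1 - x j ^ 2)) * (ε / (1 - ε))) ≤ P (j + 1))
    (hsmall : ∀ j ≤ K, exp 1 * α j * (Λ j + P j * x j ^ 2 / (1 - x j ^ 2)) / κ j ^ 2 ≤ ε) :
    ∀ j < K, exp 1 * α j * (Λ j + flowD x α κ Λ j * x j ^ 2 / (1 - x j ^ 2)) / κ j ^ 2 < 1 :=
  fun j hj => ((flowD_budget hα hκ hΛ hx hε1 P hP K hPstep hsmall j hj.le).2.2).trans_lt hε1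

/-- **Hypothesis `hstep` of the refined flow theorem** holds with equality for `flowD` (any `ρ`, `t` with
`x_j = e²(κ_j+ρ_j)t_j`). [cite: BenfattoGiulianiMastropietro2006, §2.8 (2.85)-(2.88)] -/
theorem flowD_hstep (ρ t : ℕ → ℝ) (hxdef : ∀ j, x j = exp 2 * (κ j + ρ j) * t j) (K : ℕ) :
    ∀ j < K,
      exp 1 * (flowD x α κ Λ j * (exp 2 * (κ j + ρ j) * t j) ^ 2 / (1 - (exp 2 * (κ j + ρ j) * t j) ^ 2) +
        (Λ j + flowD x α κ Λ j * (exp 2 * (κ j + ρ j) * t j) ^ 2 / (1 - (exp 2 * (κ j + ρ j) * t j) ^ 2)) *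
          (exp 1 * α j * (Λ j + flowD x α κ Λ j * (exp 2 * (κ j + ρ j) * t j) ^ 2 /
            (1 - (exp 2 * (κ j + ρ j) * t j) ^ 2)) / κ j ^ 2) /
            (1 - exp 1 * α j * (Λ j + flowD x α κ Λ j * (exp 2 * (κ j + ρ j) * t j) ^ 2 /
              (1 - (exp 2 * (κ j + ρ j) * t j) ^ 2)) / κ j ^ 2)) ≤ flowD x α κ Λ (j + 1) := by
  intro j _
  rw [flowD_succ, ← hxdef j]

/-- **The budget lemma, quadratic form** (keeps the smallness of `θ_j` in the source term: the step hypothesis is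
`e (g_j P_j + (Λ_j + g_j P_j) Θ_j/(1-ε)) ≤ P_{j+1}` with `Θ_j = e α_j (Λ_j + g_j P_j)/κ_j²` the budgeted `θ_j`; this is the form in
which the recursion closes over logarithmically many scales, BGM (2.88)). [cite: BenfattoGiulianiMastropietro2006, §2.8 (2.85)-(2.88)] -/
theorem flowD_budget_quadratic (hα : ∀ j, 0 ≤ α j) (hκ : ∀ j, 0 < κ j) (hΛ : ∀ j, 0 ≤ Λ j) (hx : ∀ j, x j ^ 2 < 1)
    {ε : ℝ} (hε1 : ε < 1) (P : ℕ → ℝ) (hP : ∀ j, 0 ≤ P j) (K : ℕ)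
    (hPstep : ∀ j < K, exp 1 * (P j * x j ^ 2 / (1 - x j ^ 2) + (Λ j + P j * x j ^ 2 / (1 - x j ^ 2)) *
      (exp 1 * α j * (Λ j + P j * x j ^ 2 / (1 - x j ^ 2)) / κ j ^ 2) / (1 - ε)) ≤ P (j + 1))
    (hsmall : ∀ j ≤ K, exp 1 * α j * (Λ j + P j * x j ^ 2 / (1 - x j ^ 2)) / κ j ^ 2 ≤ ε) :
    ∀ j ≤ K, 0 ≤ flowD x α κ Λ j ∧ flowD x α κ Λ j ≤ P j ∧
      exp 1 * α j * (Λ j + flowD x α κ Λ j * x j ^ 2 / (1 - x j ^ 2)) / κ j ^ 2 ≤ ε := by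
  have hg : ∀ j, 0 ≤ x j ^ 2 / (1 - x j ^ 2) := fun j => div_nonneg (sq_nonneg _) (by linarith [hx j])
  -- monotonicity of `θ` in `D`
  have hθ_mono : ∀ j, ∀ D D' : ℝ, D ≤ D' →
      exp 1 * α j * (Λ j + D * x j ^ 2 / (1 - x j ^ 2)) / κ j ^ 2 ≤ exp 1 * α j * (Λ j + D' * x j ^ 2 / (1 - x j ^ 2)) / κ j ^ 2 := by
    intro j D D' hDD'
    have h1 : D * x j ^ 2 / (1 - x j ^ 2) ≤ D' * x j ^ 2 / (1 - x j ^ 2) := by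
      rw [mul_div_assoc, mul_div_assoc]; exact mul_le_mul_of_nonneg_right hDD' (hg j)
    exact div_le_div_of_nonneg_right (mul_le_mul_of_nonneg_left (by linarith) (mul_nonneg (exp_pos 1).le (hα j)))
      (pow_pos (hκ j) 2).le
  have hinv : ∀ j ≤ K, 0 ≤ flowD x α κ Λ j ∧ flowD x α κ Λ j ≤ P j := by
    intro j
    induction j with
    | zero => intro _; exact ⟨le_rfl, by rw [flowD_zero]; exact hP 0⟩
    | succ j ih =>
      intro hj
      have hjK : j < K := Nat.lt_of_succ_le hj
      obtain ⟨h0, hPj⟩ := ih hjK.le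
      set D := flowD x α κ Λ j with hD
      set θ := exp 1 * α j * (Λ j + D * x j ^ 2 / (1 - x j ^ 2)) / κ j ^ 2 with hθdef
      set Θ := exp 1 * α j * (Λ j + P j * x j ^ 2 / (1 - x j ^ 2)) / κ j ^ 2 with hΘdef
      have hθΘ : θ ≤ Θ := hθ_mono j D (P j) hPj
      have hΘε : Θ ≤ ε := hsmall j hjK.le
      have hDg : 0 ≤ D * x j ^ 2 / (1 - x j ^ 2) := by rw [mul_div_assoc]; exact mul_nonneg h0 (hg j)
      have hθ0 : 0 ≤ θ := by
        rw [hθdef]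
        exact div_nonneg (mul_nonneg (mul_nonneg (exp_pos 1).le (hα j)) (by linarith [hΛ j])) (pow_pos (hκ j) 2).le
      have hθ1 : θ < 1 := lt_of_le_of_lt (hθΘ.trans hΘε) hε1
      have hDgP : D * x j ^ 2 / (1 - x j ^ 2) ≤ P j * x j ^ 2 / (1 - x j ^ 2) := by
        rw [mul_div_assoc, mul_div_assoc]; exact mul_le_mul_of_nonneg_right hPj (hg j)
      have hfrac : θ / (1 - θ) ≤ Θ / (1 - ε) := by
        rw [div_le_div_iff₀ (by linarith) (by linarith)]
        nlinarith [hθΘ, hΘε, hθ0]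
      have hfrac0 : 0 ≤ θ / (1 - θ) := div_nonneg hθ0 (by linarith)
      rw [flowD_succ, ← hD]
      refine ⟨?_, ?_⟩
      · exact mul_nonneg (exp_pos 1).le (add_nonneg hDg (div_nonneg (mul_nonneg (by linarith [hΛ j]) hθ0) (by linarith)))
      · refine le_trans ?_ (hPstep j hjK)
        refine mul_le_mul_of_nonneg_left ?_ (exp_pos 1).le
        have hA : (Λ j + D * x j ^ 2 / (1 - x j ^ 2)) * θ / (1 - θ) = (Λ j + D * x j ^ 2 / (1 - x j ^ 2)) * (θ / (1 - θ)) := by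
          ring
        have hB : (Λ j + P j * x j ^ 2 / (1 - x j ^ 2)) * Θ / (1 - ε) = (Λ j + P j * x j ^ 2 / (1 - x j ^ 2)) * (Θ / (1 - ε)) := by
          ring
        rw [hA, hB]
        exact add_le_add hDgP (mul_le_mul (by linarith) hfrac hfrac0 (by linarith [hΛ j, (hg j), mul_nonneg (hP j) (hg j)]))
  intro j hj
  obtain ⟨h0, hPj⟩ := hinv j hj
  exact ⟨h0, hPj, (hθ_mono j _ _ hPj).trans (hsmall j hj)⟩

/-- **Hypothesis `hθ` of the refined flow theorem** from a quadratic budget. [cite: BenfattoGiulianiMastropietro2006, §2.8 (2.85)-(2.88)] -/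
theorem flowD_hθ_quadratic (hα : ∀ j, 0 ≤ α j) (hκ : ∀ j, 0 < κ j) (hΛ : ∀ j, 0 ≤ Λ j) (hx : ∀ j, x j ^ 2 < 1)
    {ε : ℝ} (hε1 : ε < 1) (P : ℕ → ℝ) (hP : ∀ j, 0 ≤ P j) (K : ℕ)
    (hPstep : ∀ j < K, exp 1 * (P j * x j ^ 2 / (1 - x j ^ 2) + (Λ j + P j * x j ^ 2 / (1 - x j ^ 2)) *
      (exp 1 * α j * (Λ j + P j * x j ^ 2 / (1 - x j ^ 2)) / κ j ^ 2) / (1 - ε)) ≤ P (j + 1))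
    (hsmall : ∀ j ≤ K, exp 1 * α j * (Λ j + P j * x j ^ 2 / (1 - x j ^ 2)) / κ j ^ 2 ≤ ε) :
    ∀ j < K, exp 1 * α j * (Λ j + flowD x α κ Λ j * x j ^ 2 / (1 - x j ^ 2)) / κ j ^ 2 < 1 :=
  fun j hj => ((flowD_budget_quadratic hα hκ hΛ hx hε1 P hP K hPstep hsmall j hj.le).2.2).trans_lt hε1

end Literature.MathematicalPhysics.QuantumLattice

end
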